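import Summits.QuantumFields.BalabanUV.T4Continuum.Support.DirichletScalarTowerMonotone

/-!
# `BalabanUV.T4Continuum.Support.DirichletMonotoneExamples` — NE2 (node U1a) formalisation swarm, SUPPLIER item «Δ1-BESOV» under the
# owner's sub-row `T4-U1a.S-NE2-D1-DIRICHLET°`: RE-ENTRANT MEMBERS OF THE LOCALLY MONOTONE CLASS — the COMPLEMENT of every coordinate
# box of unit blocks (torus-minus-a-box, the orthant-complement vertex geometry of the numerical census `t4/T4-EST-NE2-D1-INJ.md`) is
# locally monotone, hence carries the unconditional Ω-restricted scalar two-level law and tower limit at rate `(√L)⁻¹`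
# (unit b2b-balaban-t4-ne2-formalise-leaf-08, gen 3, v1)

HONEST FRAMING.  Rung (B)+1 bookkeeping at MODEL level (U = 1 scalar layer), finite torus; NE2 (U1a) is NOT proved by this file; spine
PROVED 0/9 unchanged; NOT infinite volume, NOT the mass gap, NOT Clay.  HONEST DEPENDENCY (verbatim): «continuum YM on T⁴ ⇐ BetaPertH ∧
nine spine estimates (0/9 proved); BetaPertH ⇐ (D1) ∧ (D4) ∧ CAP+tail; G-an2-4 gates asym, D1 and NE2/3/4.»

WHY.  Road P2's box END (`DirichletBoxTwoLevel.injected_le_box`, owner's `DirichletScalarTowerBox`) covers CORNER-FREE regions; the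
numerical census of the wall `hinj` (leaf-07-g4) measured the RE-ENTRANT geometries «torus minus a block» (d = 2, 3) and the
«orthant-complement vertex» (d = 4).  These are complements of coordinate boxes.  THIS FILE (0 sorry; [folklore]):
 * §1 **`locallyMonotone_compl_of_isCoordBox`**: the complement `fun b => ¬ S b` of a coordinate box `S` is LOCALLY MONOTONE (at a vertex
   `v` and axis `μ`: if `v μ ∈ S₀ μ` the patch is downward-closed for the complement, otherwise upward-closed — membership of the box is
   coordinatewise);
 * §2 the kernel corollaries BY NAME: **`injected_le_of_compl_isCoordBox`** (module (III)'s END: the two-level injected law with NO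
   displayed binder on the complement of a box, rate `besovConst·√R/√N`) and
   **`towerLimitRate_dirichletScalar_complBox (hL : 2 ≤ L) (hd : 0 < d) (ha′ : 0 < a′) (hS : IsCoordBox M S)`**: the Ω-restricted
   unit-lattice scalar free covariances on the COMPLEMENT of a box converge at rate `(√L)⁻¹`, UNCONDITIONALLY — the census geometries are
   theorems (at the Besov rate; the census measures the torus rate).

ABSOLUTE RULE (cell, verbatim): «No internally-minted statement may enter as a cited fact. Every hypothesis is either kernel-proved in
this package or a verbatim quotation of a PUBLISHED theorem with page reference. The manuscript(s) under audit are NOT citable for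
their own disputed steps — they are the thing under adjudication; programme-internal (2001/route/tribunal) claims are never citable.»
[folklore]; no `def … : Prop` fact.  NOT CLAIMED: general unions of boxes (the checkerboard pair is a union of two boxes and is NOT
locally monotone); rate `L⁻¹`; the vector layer; NE2; NE3; «not in print; our construction».
-/

noncomputable section

open scoped BigOperators ComplexConjugate Matrix Matrix.Norms.L2Operator
open Filter Topology

namespace Summit.QuantumFields.BalabanUV.T4Continuum.DirichletMonotoneExamples

open Literature.MathematicalPhysics.QuantumFieldTheory.Balaban1983to89.B5Prop11Plancherel (Tor fine unitVec)
open Literature.MathematicalPhysics.QuantumFieldTheory.Balaban1983to89.B5G183RateUnitTower (lev lev_neZero)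
open Summit.QuantumFields.BalabanUV.T4Continuum
open Summit.QuantumFields.BalabanUV.T4Continuum.CovariantAveragingTower (TowerLimitRate)
open Summit.QuantumFields.BalabanUV.T4Continuum.BackgroundResolventTower
open Summit.QuantumFields.BalabanUV.T4Continuum.ScalarAveragedPropagator (gammaPs)
open Summit.QuantumFields.BalabanUV.T4Continuum.DirichletScalarTower
open Summit.QuantumFields.BalabanUV.T4Continuum.DirichletBesovTwoLevel (besovConst)
open Summit.QuantumFields.BalabanUV.T4Continuum.DirichletMonotoneCutoff (InPatch DownClosed UpClosed LocallyMonotone)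
open Summit.QuantumFields.BalabanUV.T4Continuum.DirichletMonotoneTwoLevel (injected_le_of_locallyMonotone)
open Summit.QuantumFields.BalabanUV.T4Continuum.DirichletScalarTowerMonotone (towerLimitRate_dirichletScalar_monotone)
open Summit.QuantumFields.BalabanUV.Beta.GAN24.DirichletBoxTrace (blockReg)
open Summit.QuantumFields.BalabanUV.Beta.GAN24.DirichletBoxCompression (DOm JOm refineR)
open Summit.QuantumFields.BalabanUV.Beta.GAN24.DirichletBoxTwoLevel (IsCoordBox)

variable {d : ℕ}

/-! ## §1 Complements of coordinate boxes are locally monotone -/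

/-- **the COMPLEMENT of a coordinate box of unit blocks is locally monotone** (torus-minus-a-box, orthant complements …): at a vertex
`v` and axis `μ`, if the upper coordinate `v μ` is in the box's `μ`-set then the complement's patch is downward-closed (a lower block in the
box forces the upper block into the box), otherwise it is upward-closed (an upper block is never in the box). [folklore] -/
theorem locallyMonotone_compl_of_isCoordBox (M : Fin d → ℕ) [∀ μ, NeZero (M μ)] {S : Tor M → Prop} (hS : IsCoordBox M S) :
    LocallyMonotone M (fun b => ¬ S b) := by
  obtain ⟨S₀, hS₀⟩ := hS
  intro v μ
  by_cases hv : v μ ∈ S₀ μ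
  · -- downward-closed: `¬S b → ¬S (b − e_μ)`, i.e. `b − e_μ ∈ box → b ∈ box`
    refine Or.inl fun b _ hbμ hb hb' => hb ?_
    rw [hS₀] at hb' ⊢
    intro ν
    by_cases hν : ν = μ
    · subst hν; rw [← hbμ]; exact hv
    · simpa [unitVec, hν] using hb' ν
  · -- upward-closed: `b + e_μ` has `μ`-coordinate `v μ ∉ S₀ μ`, so it is never in the box
    refine Or.inr fun b _ hbμ _ hb' => hv ?_
    rw [hS₀] at hb'
    simpa [unitVec, hbμ] using hb' μ

/-! ## §2 The kernel corollaries on the complement of a box -/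

section TwoLevel

variable (N R : ℕ) [NeZero N] [NeZero R] (M : Fin d → ℕ) [hM : ∀ μ, NeZero (M μ)] (S : Tor M → Prop) [DecidablePred S]

/-- **the Dirichlet two-level injected law on the COMPLEMENT of a coordinate box** (U = 1 scalar, no displayed binder, rate
`besovConst·√R/√N`). [folklore] -/
theorem injected_le_of_compl_isCoordBox (hS : IsCoordBox M S) (hN : 1 ≤ N) (hRN : 2 ≤ R * N) {a' : ℝ} (ha' : 0 < a') :
    ‖(DOm (R * N) M a' (refineR N R M (blockReg N M fun b => ¬ S b)))⁻¹ * JOm N R M (blockReg N M fun b => ¬ S b)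
        - JOm N R M (blockReg N M fun b => ¬ S b) * (DOm N M a' (blockReg N M fun b => ¬ S b))⁻¹‖
      ≤ besovConst d a' 6 48 * Real.sqrt R / Real.sqrt N :=
  injected_le_of_locallyMonotone N R M (fun b => ¬ S b) (locallyMonotone_compl_of_isCoordBox M hS) hN hRN ha'

end TwoLevel

section Tower

variable (L : ℕ) [NeZero L] (M : Fin d → ℕ) [hM : ∀ μ, NeZero (M μ)] (a' : ℝ) (S : Tor M → Prop) [DecidablePred S]

/-- **THE Ω-RESTRICTED UNIT-LATTICE SCALAR FREE COVARIANCES ON THE COMPLEMENT OF A BOX CONVERGE AT THE RATE `(√L)⁻¹`** — the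
torus-minus-a-block ∕ orthant-complement geometries of the Δ1 numerical census are THEOREMS of the Besov route (displayed: `2 ≤ L`,
`0 < d`, `0 < a′`, `IsCoordBox M S`; the region is the COMPLEMENT of `S`). [folklore] -/
theorem towerLimitRate_dirichletScalar_complBox (hL : 2 ≤ L) (hd : 0 < d) (ha' : 0 < a') (hS : IsCoordBox M S) :
    TowerLimitRate (QsR L M (blockReg (lev L 0) M fun b => ¬ S b)) ((L : ℝ) ^ d)
      (fun k => (DsR L M a' (blockReg (lev L 0) M fun b => ¬ S b) k)⁻¹)
      (Cpert 0 (2 * d * Real.sqrt ((gammaPs d a')⁻¹)) (besovConst d a' 6 48 * Real.sqrt (L : ℝ)) 0 0 0) ((Real.sqrt (L : ℝ))⁻¹) :=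
  towerLimitRate_dirichletScalar_monotone L M a' (fun b => ¬ S b) hL hd ha' (locallyMonotone_compl_of_isCoordBox M hS)

end Tower

end Summit.QuantumFields.BalabanUV.T4Continuum.DirichletMonotoneExamples

end
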